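import Summits.AtomisticToContinuum.BoseEinsteinCondensation.Theses.BECCutLineWeakDisorder
import Literature.MathematicalPhysics.QuantumManyBody.GroundState
import Literature.MathematicalPhysics.QuantumManyBody.GroundStateFeynmanKacProofs
import Summits.AtomisticToContinuum.BoseEinsteinCondensation.Theorems.BECCutLineWeakDisorderGroundStateRigidityStubCompactness
import Summits.AtomisticToContinuum.BoseEinsteinCondensation.Theorems.BECCutLineWeakDisorderGroundStateRigidityStubRigidityOfUnique
import Summits.AtomisticToContinuum.BoseEinsteinCondensation.Theorems.BECCutLineWeakDisorderGroundStateRigidityStubFkJensen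
import Summits.AtomisticToContinuum.BoseEinsteinCondensation.Theorems.BECCutLineWeakDisorderGroundStateRigidityStubStabilityOfJensen
import Summits.AtomisticToContinuum.BoseEinsteinCondensation.Theorems.BECCutLineWeakDisorderGroundStateRigidityStubUniqueOfStability
import Summits.AtomisticToContinuum.BoseEinsteinCondensation.Theorems.BECCutLineWeakDisorderGroundStateRigidityStubFiniteEnergyLowDensity
import Summits.AtomisticToContinuum.BoseEinsteinCondensation.Theorems.BECCutLineWeakDisorderGroundStateRigidityStubExistsNonnegGroundState
import HarnessLib

/-!
# Crux `GroundStateRigidity` (stmt-AtomisticToContinuum-9072), line `Sketch`: what the landed stubs prove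

Route `BECCutLineWeakDisorder` (decl
`Summit.AtomisticToContinuum.BoseEinsteinCondensation.Theses.BECCutLineWeakDisorder.GroundStateRigidity`, shared
verbatim by `BECClassicalWindow`, `BECRieszReverseHolder`, `BECThermalBridge`, `BECCellInformation`, `BECNudgeWalk`,
`BECHeatBathGap`, `BECWallDressingTransfer`).  Assembled from the seven landed stub files of the line
(`…StubCompactness`, `…StubRigidityOfUnique`, `…StubFkJensen`, `…StubStabilityOfJensen`, `…StubUniqueOfStability`,
`…StubFiniteEnergyLowDensity`, `…StubExistsNonnegGroundState`), sorry-free: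

* `hasUniqueGroundState_of_bounded` — **nondegeneracy of the Dirichlet ground state for BOUNDED pair
  potentials** in the closed-form (variational) vocabulary of `GroundState.lean`: for measurable bounded `v`,
  `N ≥ 1`, `L > 0`, `HasUniqueGroundState v N L` (Perron–Frobenius for the Feynman–Kac semigroup, transported
  to minimisers of the closed form by the Jensen / stability form bounds).  Reed–Simon IV Thms XIII.44–47.
* `rigid_of_bounded` — **rigidity of near-minimisers at EVERY box for bounded `v`**: for every `η > 0` some
  `δ > 0` makes any two `δ`-near-minimisers `η`-close in `L²` up to a phase (compact resolvent + simple ground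
  state; no density condition is needed when `v` is bounded).
* `groundStateRigidity_of_bounded` — the crux's conclusion for bounded admissible `v`, at every density.
* `groundStateRigidity_of_uniquenessKernel` — **the reduction**: the crux `GroundStateRigidity` follows, for
  ALL admissible `v`, from the one open kernel (uniqueness up to phase of the closed-form ground state at low density,
  eventually in `N`, for UNBOUNDED admissible `v`: hard cores, shells, singular cores), taken as a
  hypothesis written out verbatim as registered on the item (`stub_uniquenessKernel`; the dilute component
  of the finite-energy region should be the unique energy-minimising one — open for hard cores,
  Baryshnikov–Bubenik–Kahle 2013 §6; genuinely density-dependent: two unit hard spheres in a box with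
  `1/3 < L² < 1/2` are degenerate, `Theorems/GroundStateRigidity/Negative/`).
-/

noncomputable section

open MeasureTheory Filter Metric
open scoped ENNReal NNReal Topology

namespace Summit.AtomisticToContinuum.BoseEinsteinCondensation.Theorems.GroundStateRigidity

open Literature.MathematicalPhysics.QuantumManyBody.BoseGas
open Summit.AtomisticToContinuum.BoseEinsteinCondensation.Theses.BECCutLineWeakDisorder

/-- **Nondegeneracy of the Dirichlet ground state for bounded pair potentials** (closed-form version):
for measurable bounded `v`, `N ≥ 1` and `L > 0` a nonnegative ground state exists and ground states are
unique up to a constant phase.  Chain: `E₀ < ⊤` (`GroundStateFeynmanKac_holds`), Feynman–Kac Jensen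
inequality (`stub_fkJensen`), spectral-gap stability (`stub_stabilityOfJensen`), uniqueness from stability
and Rellich compactness (`stub_uniqueOfStability`, `stub_compactness`).
[cite: ReedSimonIV1978, §XIII.12 Thms XIII.44–XIII.47] -/
theorem hasUniqueGroundState_of_bounded :
    ∀ (N : ℕ) (v : ℝ → ℝ≥0∞) (C : ℝ≥0) (L : ℝ), 1 ≤ N → Measurable v → (∀ r, v r ≤ C) → 0 < L →
      HasUniqueGroundState v N L := by
  intro N v C L hN hv hC hL
  obtain ⟨Ψ₀, hΨ₀, -, -⟩ := GroundStateFeynmanKac_holds N L v hN hL hv ⟨C, hC⟩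
  exact stub_uniqueOfStability stub_compactness N v L hΨ₀.energy_ne_top
    (stub_stabilityOfJensen N v C L hN hv hC hL (stub_fkJensen N v C L hv hC hL))

/-- **Rigidity of near-minimisers for bounded pair potentials, at every box**: for measurable bounded
`v`, `N ≥ 1`, `L > 0` and every `η > 0` there is `δ > 0` such that any two trial states with energy
`≤ E₀(N, L) + δ` satisfy `∫|Ψ − cΦ|² ≤ η` for some unit `c` (uniqueness above + compactness,
`stub_rigidityOfUnique`). [cite: ReedSimonIV1978, §XIII.12 Thm XIII.47 and Thm XIII.64] -/
theorem rigid_of_bounded :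
    ∀ (N : ℕ) (v : ℝ → ℝ≥0∞) (C : ℝ≥0) (L : ℝ), 1 ≤ N → Measurable v → (∀ r, v r ≤ C) → 0 < L →
      ∀ η : ℝ, 0 < η → ∃ δ : ℝ≥0∞, 0 < δ ∧ ∀ Ψ Φ : TrialState N L,
        energy v Ψ ≤ groundStateEnergy v N L + δ → energy v Φ ≤ groundStateEnergy v N L + δ →
        ∃ c : ℂ, ‖c‖ = 1 ∧ ∫⁻ X, (‖Ψ.ψ X - c * Φ.ψ X‖₊ : ℝ≥0∞) ^ 2 ≤ ENNReal.ofReal η :=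
  fun N v C L hN hv hC hL =>
    stub_rigidityOfUnique stub_compactness v N L (hasUniqueGroundState_of_bounded N v C L hN hv hC hL)

/-- **The crux `GroundStateRigidity` restricted to BOUNDED potentials holds — at every density**: for
measurable bounded `v`, every `ρ > 0` and all `N ≥ 1`, near-minimisers in the box of side `(N/ρ)^{1/3}`
are rigid. (Finite range and low density are not needed in the bounded case.)
[cite: ReedSimonIV1978, §XIII.12 Thm XIII.47] -/
theorem groundStateRigidity_of_bounded :
    ∀ v : ℝ → ℝ≥0∞, Measurable v → (∃ C : ℝ≥0, ∀ r, v r ≤ C) →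
      ∀ ρ : ℝ, 0 < ρ → ∀ᶠ N : ℕ in atTop, ∀ η : ℝ, 0 < η → ∃ δ : ℝ≥0∞, 0 < δ ∧
        ∀ Ψ Φ : TrialState N (sideLength ρ N),
          energy v Ψ ≤ groundStateEnergy v N (sideLength ρ N) + δ →
          energy v Φ ≤ groundStateEnergy v N (sideLength ρ N) + δ →
          ∃ c : ℂ, ‖c‖ = 1 ∧ ∫⁻ X, (‖Ψ.ψ X - c * Φ.ψ X‖₊ : ℝ≥0∞) ^ 2 ≤ ENNReal.ofReal η := by
  intro v hv hb ρ hρ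
  obtain ⟨C, hC⟩ := hb
  filter_upwards [eventually_ge_atTop 1] with N hN
  exact rigid_of_bounded N v C (sideLength ρ N) hN hv hC (by
      unfold sideLength
      exact Real.rpow_pos_of_pos (div_pos (by exact_mod_cast hN) hρ) _)

/-- **Eventual uniqueness for every admissible `v`, given the kernel**: bounded `v` by
`hasUniqueGroundState_of_bounded` (any `ρ`, all `N ≥ 1`); unbounded `v` by finite energy at low density
(`stub_finiteEnergyLowDensity`), existence of a nonnegative ground state (`stub_existsNonnegGroundState` +
`stub_compactness`) and the kernel. [folklore] -/
theorem eventually_hasUniqueGroundState_of_uniquenessKernel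
    (hK : (∀ v : ℝ → ℝ≥0∞, IsRepulsiveFiniteRange v → (¬ ∃ C : ℝ≥0, ∀ r, v r ≤ C) →
      ∃ ρ₀ : ℝ, 0 < ρ₀ ∧ ∀ ρ : ℝ, 0 < ρ → ρ < ρ₀ → ∀ᶠ N : ℕ in atTop,
        ∀ Ψ Φ : Config N → ℂ, IsGroundState v (sideLength ρ N) Ψ →
          IsGroundState v (sideLength ρ N) Φ →
          ∃ c : ℂ, ‖c‖ = 1 ∧ ∀ᵐ X : Config N, Φ X = c * Ψ X))
    (v : ℝ → ℝ≥0∞) (hv : IsRepulsiveFiniteRange v) :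
    ∃ ρ₀ : ℝ, 0 < ρ₀ ∧ ∀ ρ : ℝ, 0 < ρ → ρ < ρ₀ → ∀ᶠ N : ℕ in atTop,
      HasUniqueGroundState v N (sideLength ρ N) := by
  by_cases hb : ∃ C : ℝ≥0, ∀ r, v r ≤ C
  · obtain ⟨C, hC⟩ := hb
    refine ⟨1, one_pos, fun ρ hρ _ => ?_⟩
    filter_upwards [eventually_ge_atTop 1] with N hN
    exact hasUniqueGroundState_of_bounded N v C (sideLength ρ N) hN hv.1 hC (by
      unfold sideLength
      exact Real.rpow_pos_of_pos (div_pos (by exact_mod_cast hN) hρ) _)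
  · obtain ⟨ρ₁, hρ₁, h₁⟩ := stub_finiteEnergyLowDensity v hv
    obtain ⟨ρ₂, hρ₂, h₂⟩ := hK v hv hb
    refine ⟨min ρ₁ ρ₂, lt_min hρ₁ hρ₂, fun ρ hρ hρm => ?_⟩
    filter_upwards [h₁ ρ hρ (hρm.trans_le (min_le_left _ _)),
      h₂ ρ hρ (hρm.trans_le (min_le_right _ _))] with N hE hU
    exact ⟨stub_existsNonnegGroundState stub_compactness N v (sideLength ρ N) hE, hU⟩

/-- **Reduction of the crux to its kernel**: (uniqueness kernel for unbounded admissible `v`) →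
`GroundStateRigidity` (eventual uniqueness above, then rigidity from uniqueness and compactness,
`stub_rigidityOfUnique`). Proving the registered stub `stub_uniquenessKernel` closes item
stmt-AtomisticToContinuum-9072 in one line. [cite: ReedSimonIV1978, §XIII.12 Thm XIII.48] -/
theorem groundStateRigidity_of_uniquenessKernel :
    (∀ v : ℝ → ℝ≥0∞, IsRepulsiveFiniteRange v → (¬ ∃ C : ℝ≥0, ∀ r, v r ≤ C) →
      ∃ ρ₀ : ℝ, 0 < ρ₀ ∧ ∀ ρ : ℝ, 0 < ρ → ρ < ρ₀ → ∀ᶠ N : ℕ in atTop,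
        ∀ Ψ Φ : Config N → ℂ, IsGroundState v (sideLength ρ N) Ψ →
          IsGroundState v (sideLength ρ N) Φ →
          ∃ c : ℂ, ‖c‖ = 1 ∧ ∀ᵐ X : Config N, Φ X = c * Ψ X) →
    GroundStateRigidity := by
  intro hK v hv
  obtain ⟨ρ₀, hρ₀, hU⟩ := eventually_hasUniqueGroundState_of_uniquenessKernel hK v hv
  refine ⟨ρ₀, hρ₀, fun ρ hρ hρ₀' => ?_⟩
  filter_upwards [hU ρ hρ hρ₀'] with N hN
  intro η hη
  exact stub_rigidityOfUnique stub_compactness v N (sideLength ρ N) hN η hη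

end Summit.AtomisticToContinuum.BoseEinsteinCondensation.Theorems.GroundStateRigidity

end
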